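import Summits.CriticalPhenomena.CardyFormulaZ2.Theses.CardyBoundaryCoulombGas
import Summits.CriticalPhenomena.CardyFormulaZ2.Theorems.CardyBoundaryCoulombGasBoundaryDefectGaussianRH19SquareConformalMap
import Summits.CriticalPhenomena.CardyFormulaZ2.Theorems.CardyBoundaryCoulombGasBoundaryDefectGaussianRH19BoxRatio
import Summits.CriticalPhenomena.CardyFormulaZ2.Theorems.CardyBoundaryCoulombGasBoundaryDefectGaussianRH19ConnLeArmSq
import Summits.CriticalPhenomena.CardyFormulaZ2.Theorems.CardyBoundaryCoulombGasBoundaryDefectGaussianRH19ArmSqLeConn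
import Summits.CriticalPhenomena.CardyFormulaZ2.Theorems.CardyBoundaryCoulombGasBoundaryDefectGaussianRH19Exponent
import Summits.CriticalPhenomena.CardyFormulaZ2.Theorems.CardyBoundaryCoulombGasBoundaryDefectGaussianRH19BoxGreen
import Summits.CriticalPhenomena.CardyFormulaZ2.Theorems.CardyBoundaryCoulombGasBoundaryDefectGaussianRH19Crux22
import Summits.CriticalPhenomena.CardyFormulaZ2.Theorems.CardyBoundaryCoulombGasBoundaryDefectGaussianRH19Canon22
import Summits.CriticalPhenomena.CardyFormulaZ2.Theorems.HalfPlaneOneArmThird.Negative.Basics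
import Literature.Probability.Percolation.HalfPlaneOneArmQuasiMultiplicativity
import Literature.Probability.Percolation.HalfPlaneArmAxisInputs
import Literature.Probability.RandomPlanarGeometry.RectangleConformalMap
import HarnessLib

/-!
# Hardness certificate for crux `BoundaryDefectGaussianR` (stmt-CriticalPhenomena-14132): the crux, and
# already the registered stub CANON of line `rainbow-monomials-in-excursion-kernels`, imply crux 6
# `HalfPlaneOneArmThird` (the half-plane one-arm exponent `1/3` of bond percolation on `ℤ²`, open)

Lead seat c4 of the line. The line (skeleton v7, `Cruxes/BoundaryDefectGaussianR/Lines/rainbow_monomials_in_excursion_kernels.lean`)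
reduced the crux to three stubs, two of which — `stub_pointTransport` (PT) and `stub_canonicalLimit` (CANON) — are
the SHARP (ratio-limit) asymptotics of boundary rainbow probabilities of critical bond percolation on `ℤ²`, for
which not even the exponents are known on `ℤ²`; seat c3 ended `promote-stub`. This file makes that verdict
machine-checked:

* `halfPlaneOneArmThird_of_boundaryDefectGaussianR : BoundaryDefectGaussianR → HalfPlaneOneArmThird` — the
  `(2;2)` member of the crux on the lattice squares `[-12(n+1), 12(n+1)]²` (mesh `1/(12(n+1))` of the reference
  square `(-1,1)²`, marks `(∓1/3, -1)`) is, by the insertion dictionary (`h19_boxRatio_eq_conn`), the sharp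
  `δ^{2/3}` asymptotics of the boundary two-point connection probability `P_n` of the two bottom-row points
  (`h19_crux22`, fed with the conformal map of the square `h19_squareConformalMap`: Riemann map + Cayley +
  Schwarz reflection), and `c θ(12(n+1))² ≤ P_n ≤ θ(4n+3)²` for the half-plane one-arm probability `θ`
  (`h19_armSq_le_conn`: gluing through a U, Harris–FKG; `h19_conn_le_armSq`: first exit, independence), whence
  `log θ(n)/log n → -1/3` (`h19_exponent_of_twoSided`);
* `halfPlaneOneArmThird_of_canonicalLimit : CANON → HalfPlaneOneArmThird` — the same with CANON's `(2;2)` member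
  (`h19_canon22`) and the landed Green asymptotics of the squares (`h19_boxGreen`, from GREEN with both
  Poisson-kernel facts proved) in place of the crux.

So the simplest non-trivial member of the crux, and the stub CANON alone, contain crux 6 of the route
(`Theses.CardyBoundaryCoulombGas.HalfPlaneOneArmThird`, conjecturally `β₁⁺ = 1/3`; a theorem only on site-`𝕋`).
All eight `h19_*` sub-goals are landed Theorems files of this line; this file is the ≤ 150-line assembly.
-/

noncomputable section

open Filter Topology Set MeasureTheory
open Literature.Probability.RandomPlanarGeometry Literature.Probability.LatticeModels
  Literature.Probability.LatticeModels.CollarLegModel Literature.Probability.Percolation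

namespace Summit.CriticalPhenomena.CardyFormulaZ2.Cruxes.BoundaryDefectGaussianR.RainbowMonomialsInExcursionKernels

/-! ### Composition: two-sided `δ^{2/3}` asymptotics of the two-point function on the squares give crux 6 -/

/-- Shorthand-free composition lemma: if along the squares the two-point connection probability `P_n` of the
two bottom-row points satisfies `a δ_n^{2/3} ≤ P_n ≤ b δ_n^{2/3}` eventually (`δ_n = 1/(12(n+1))`), then
`HalfPlaneOneArmThird` (Stubs H3, H4, H5). [folklore] -/
theorem h19_oneArmThird_of_twoPointBounds (a b : ℝ) (ha : 0 < a) (hb : 0 < b)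
    (hP : ∀ᶠ n : ℕ in Filter.atTop,
      a * ((n : ℝ) + 1) ^ (-(2 / 3 : ℝ)) ≤
        (bondPercolation (zdGraph 2) half).real
          (openConnIn
            {v : Site 2 | (-(12 * ((n : ℤ) + 1)) ≤ v 0 ∧ v 0 ≤ 12 * ((n : ℤ) + 1)) ∧
              (-(12 * ((n : ℤ) + 1)) ≤ v 1 ∧ v 1 ≤ 12 * ((n : ℤ) + 1))}
            (![-(4 * ((n : ℤ) + 1)), -(12 * ((n : ℤ) + 1))] : Site 2)
            (![4 * ((n : ℤ) + 1), -(12 * ((n : ℤ) + 1))] : Site 2)) ∧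
      (bondPercolation (zdGraph 2) half).real
          (openConnIn
            {v : Site 2 | (-(12 * ((n : ℤ) + 1)) ≤ v 0 ∧ v 0 ≤ 12 * ((n : ℤ) + 1)) ∧
              (-(12 * ((n : ℤ) + 1)) ≤ v 1 ∧ v 1 ≤ 12 * ((n : ℤ) + 1))}
            (![-(4 * ((n : ℤ) + 1)), -(12 * ((n : ℤ) + 1))] : Site 2)
            (![4 * ((n : ℤ) + 1), -(12 * ((n : ℤ) + 1))] : Site 2)) ≤ b * ((n : ℝ) + 1) ^ (-(2 / 3 : ℝ))) :
    Summit.CriticalPhenomena.CardyFormulaZ2.Theses.CardyBoundaryCoulombGas.HalfPlaneOneArmThird := by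
  rw [Summit.CriticalPhenomena.CardyFormulaZ2.Theorems.HalfPlaneOneArmThird.Negative.crux_iff]
  obtain ⟨c, hc, N₀, hlow⟩ := h19_armSq_le_conn
  set θ : ℕ → ℝ := Summit.CriticalPhenomena.CardyFormulaZ2.Theorems.HalfPlaneOneArmThird.Negative.prob half
    with hθ
  have hanti : Antitone θ := by
    intro m n hmn
    simp only [hθ, Summit.CriticalPhenomena.CardyFormulaZ2.Theorems.HalfPlaneOneArmThird.Negative.prob,
      Summit.CriticalPhenomena.CardyFormulaZ2.Theorems.HalfPlaneOneArmThird.Negative.armEvt,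
      Summit.CriticalPhenomena.CardyFormulaZ2.Theorems.HalfPlaneOneArmThird.Negative.halfBox]
    rw [HalfPlaneArm.axisArm_eq, HalfPlaneArm.axisArm_eq]
    exact HalfPlaneArm.real_arm_anti (X := fun v : Site 2 => v 0) (Y := fun v : Site 2 => v 1)
      HalfPlaneArm.axis_X_le HalfPlaneArm.axis_Y_le half 0 (by positivity) (by exact_mod_cast hmn)
  have hpos : ∀ n, 0 < θ n := fun n =>
    Summit.CriticalPhenomena.CardyFormulaZ2.Theorems.HalfPlaneOneArmThird.Negative.prob_pos (p := half)
      (by rw [coe_half]; norm_num) n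
  refine h19_exponent_of_twoSided θ hanti hpos a (b / c) ha (div_pos hb hc) ?_
  filter_upwards [hP, Filter.eventually_ge_atTop N₀] with n hn hN
  constructor
  · exact hn.1.trans (h19_conn_le_armSq n)
  · have h1 := hlow n hN
    rw [div_mul_eq_mul_div, le_div_iff₀ hc]
    calc θ (12 * (n + 1)) ^ 2 * c = c * θ (12 * (n + 1)) ^ 2 := by ring
      _ ≤ _ := h1
      _ ≤ _ := hn.2


/-! ### The explicit lattice squares and the assembly -/

/-- The lattice squares `[-12(n+1), 12(n+1)]²` are the lattice approximations of the closed square `[-1,1]²` at mesh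
`1/(12(n+1))`. [folklore] -/
theorem h19_box_closure (n : ℕ) (v : ℤ × ℤ) :
    v ∈ (Finset.Icc (-(12 * ((n : ℤ) + 1))) (12 * ((n : ℤ) + 1))) ×ˢ (Finset.Icc (-(12 * ((n : ℤ) + 1))) (12 * ((n : ℤ) + 1))) ↔
      ((v.1 : ℂ) * (((1 / (12 * ((n : ℝ) + 1)) : ℝ) : ℝ) : ℂ) + (v.2 : ℂ) * (((1 / (12 * ((n : ℝ) + 1)) : ℝ) : ℝ) : ℂ) *
        Complex.I) ∈ closure (Literature.Probability.RandomPlanarGeometry.symRect 1 1) := by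
  have hN : (0 : ℝ) < 12 * ((n : ℝ) + 1) := by positivity
  rw [mem_closure_symRect one_pos one_pos, Finset.mem_product, Finset.mem_Icc, Finset.mem_Icc]
  have hre : ((v.1 : ℂ) * (((1 / (12 * ((n : ℝ) + 1)) : ℝ) : ℝ) : ℂ) + (v.2 : ℂ) * (((1 / (12 * ((n : ℝ) + 1)) : ℝ) : ℝ) : ℂ) *
      Complex.I).re = (v.1 : ℝ) * (1 / (12 * ((n : ℝ) + 1))) := by
    generalize (1 / (12 * ((n : ℝ) + 1)) : ℝ) = t
    simp
  have him : ((v.1 : ℂ) * (((1 / (12 * ((n : ℝ) + 1)) : ℝ) : ℝ) : ℂ) + (v.2 : ℂ) * (((1 / (12 * ((n : ℝ) + 1)) : ℝ) : ℝ) : ℂ) *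
      Complex.I).im = (v.2 : ℝ) * (1 / (12 * ((n : ℝ) + 1))) := by
    generalize (1 / (12 * ((n : ℝ) + 1)) : ℝ) = t
    simp
  rw [hre, him, mul_one_div, mul_one_div]
  have key : ∀ z : ℤ, (-(12 * ((n : ℤ) + 1)) ≤ z ∧ z ≤ 12 * ((n : ℤ) + 1)) ↔
      (-1 ≤ (z : ℝ) / (12 * ((n : ℝ) + 1)) ∧ (z : ℝ) / (12 * ((n : ℝ) + 1)) ≤ 1) := by
    intro z
    rw [le_div_iff₀ hN, div_le_iff₀ hN]
    constructor
    · rintro ⟨h1, h2⟩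
      constructor
      · have : ((-(12 * ((n : ℤ) + 1)) : ℤ) : ℝ) ≤ z := by exact_mod_cast h1
        push_cast at this; linarith
      · have : (z : ℝ) ≤ ((12 * ((n : ℤ) + 1) : ℤ) : ℝ) := by exact_mod_cast h2
        push_cast at this; linarith
    · rintro ⟨h1, h2⟩
      constructor
      · have : ((-(12 * ((n : ℤ) + 1)) : ℤ) : ℝ) ≤ z := by push_cast; linarith
        exact_mod_cast this
      · have : (z : ℝ) ≤ ((12 * ((n : ℤ) + 1) : ℤ) : ℝ) := by push_cast; linarith
        exact_mod_cast this
  rw [key v.1, key v.2]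

/-- From a positive limit of `δ_n^{-2/3} R_n` and the eventual identity `R_n = P_n`: two-sided bounds
`a (n+1)^{-2/3} ≤ P_n ≤ b (n+1)^{-2/3}` eventually (`δ_n = 1/(12(n+1))`). [folklore] -/
theorem h19_twoSided_of_limit {R P : ℕ → ℝ} {κ : ℝ} (hκ : 0 < κ)
    (hT : Filter.Tendsto (fun n : ℕ ↦ (1 / (12 * ((n : ℝ) + 1))) ^ (-(2 / 3 : ℝ)) * R n) Filter.atTop (nhds κ))
    (hE : ∀ᶠ n : ℕ in Filter.atTop, R n = P n) :
    ∃ a b : ℝ, 0 < a ∧ 0 < b ∧ ∀ᶠ n : ℕ in Filter.atTop,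
      a * ((n : ℝ) + 1) ^ (-(2 / 3 : ℝ)) ≤ P n ∧ P n ≤ b * ((n : ℝ) + 1) ^ (-(2 / 3 : ℝ)) := by
  have h12 : (0 : ℝ) < (12 : ℝ) ^ (-(2 / 3 : ℝ)) := Real.rpow_pos_of_pos (by norm_num) _
  refine ⟨κ / 2 * (12 : ℝ) ^ (-(2 / 3 : ℝ)), 2 * κ * (12 : ℝ) ^ (-(2 / 3 : ℝ)), by positivity, by positivity, ?_⟩
  have hlo : ∀ᶠ n : ℕ in Filter.atTop, κ / 2 < (1 / (12 * ((n : ℝ) + 1))) ^ (-(2 / 3 : ℝ)) * R n :=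
    hT.eventually (lt_mem_nhds (by linarith))
  have hhi : ∀ᶠ n : ℕ in Filter.atTop, (1 / (12 * ((n : ℝ) + 1))) ^ (-(2 / 3 : ℝ)) * R n < 2 * κ :=
    hT.eventually (gt_mem_nhds (by linarith))
  filter_upwards [hlo, hhi, hE] with n h1 h2 h3
  have hN : (0 : ℝ) < (n : ℝ) + 1 := by positivity
  -- `δ_n^{-2/3} = 12^{2/3} (n+1)^{2/3}` and `(n+1)^{-2/3} (n+1)^{2/3} = 1`
  have hsplit : (1 / (12 * ((n : ℝ) + 1))) ^ (-(2 / 3 : ℝ)) = ((12 : ℝ) ^ (-(2 / 3 : ℝ)))⁻¹ * ((n : ℝ) + 1) ^ (2 / 3 : ℝ) := by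
    rw [Real.rpow_neg (by positivity), one_div, Real.inv_rpow (by positivity), inv_inv,
      Real.mul_rpow (by norm_num) hN.le, Real.rpow_neg (by norm_num), inv_inv]
  have hone : ((n : ℝ) + 1) ^ (-(2 / 3 : ℝ)) * ((n : ℝ) + 1) ^ (2 / 3 : ℝ) = 1 := by
    rw [← Real.rpow_add hN]; norm_num
  have hpos23 : 0 < ((n : ℝ) + 1) ^ (-(2 / 3 : ℝ)) := Real.rpow_pos_of_pos hN _
  rw [hsplit, h3] at h1 h2
  constructor
  · -- lower bound
    have : κ / 2 * ((12 : ℝ) ^ (-(2 / 3 : ℝ))) * ((n : ℝ) + 1) ^ (-(2 / 3 : ℝ)) ≤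
        ((12 : ℝ) ^ (-(2 / 3 : ℝ)))⁻¹ * ((n : ℝ) + 1) ^ (2 / 3 : ℝ) * P n * ((12 : ℝ) ^ (-(2 / 3 : ℝ))) *
          ((n : ℝ) + 1) ^ (-(2 / 3 : ℝ)) := by gcongr
    calc κ / 2 * (12 : ℝ) ^ (-(2 / 3 : ℝ)) * ((n : ℝ) + 1) ^ (-(2 / 3 : ℝ))
        ≤ ((12 : ℝ) ^ (-(2 / 3 : ℝ)))⁻¹ * ((n : ℝ) + 1) ^ (2 / 3 : ℝ) * P n * ((12 : ℝ) ^ (-(2 / 3 : ℝ))) *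
          ((n : ℝ) + 1) ^ (-(2 / 3 : ℝ)) := this
      _ = P n * (((12 : ℝ) ^ (-(2 / 3 : ℝ)))⁻¹ * (12 : ℝ) ^ (-(2 / 3 : ℝ))) *
          (((n : ℝ) + 1) ^ (-(2 / 3 : ℝ)) * ((n : ℝ) + 1) ^ (2 / 3 : ℝ)) := by ring
      _ = P n := by rw [inv_mul_cancel₀ h12.ne', hone]; ring
  · -- upper bound
    have : ((12 : ℝ) ^ (-(2 / 3 : ℝ)))⁻¹ * ((n : ℝ) + 1) ^ (2 / 3 : ℝ) * P n * ((12 : ℝ) ^ (-(2 / 3 : ℝ))) *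
          ((n : ℝ) + 1) ^ (-(2 / 3 : ℝ)) ≤ 2 * κ * ((12 : ℝ) ^ (-(2 / 3 : ℝ))) * ((n : ℝ) + 1) ^ (-(2 / 3 : ℝ)) := by
      gcongr
    calc P n = P n * (((12 : ℝ) ^ (-(2 / 3 : ℝ)))⁻¹ * (12 : ℝ) ^ (-(2 / 3 : ℝ))) *
          (((n : ℝ) + 1) ^ (-(2 / 3 : ℝ)) * ((n : ℝ) + 1) ^ (2 / 3 : ℝ)) := by rw [inv_mul_cancel₀ h12.ne', hone]; ring
      _ = ((12 : ℝ) ^ (-(2 / 3 : ℝ)))⁻¹ * ((n : ℝ) + 1) ^ (2 / 3 : ℝ) * P n * ((12 : ℝ) ^ (-(2 / 3 : ℝ))) *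
          ((n : ℝ) + 1) ^ (-(2 / 3 : ℝ)) := by ring
      _ ≤ _ := this

/-- **Hardness certificate A.** The crux `BoundaryDefectGaussianR` implies crux 6, `HalfPlaneOneArmThird`
(the half-plane one-arm exponent `1/3` of bond percolation on `ℤ²`, open): its `(2;2)` member on the lattice squares
is the sharp `δ^{2/3}` asymptotics of a boundary two-point connection probability, which is comparable to the square
of the half-plane one-arm probability. [folklore] -/
theorem halfPlaneOneArmThird_of_boundaryDefectGaussianR :
    Summit.CriticalPhenomena.CardyFormulaZ2.Theses.CardyBoundaryCoulombGas.BoundaryDefectGaussianR →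
    Summit.CriticalPhenomena.CardyFormulaZ2.Theses.CardyBoundaryCoulombGas.HalfPlaneOneArmThird := by
  intro h
  set δ : ℕ → ℝ := fun n ↦ 1 / (12 * ((n : ℝ) + 1)) with hδ
  set V : ℕ → Finset (ℤ × ℤ) := fun n ↦
    (Finset.Icc (-(12 * ((n : ℤ) + 1))) (12 * ((n : ℤ) + 1))) ×ˢ (Finset.Icc (-(12 * ((n : ℤ) + 1))) (12 * ((n : ℤ) + 1)))
    with hVdef
  set p : ℕ → Fin 2 → ℤ × ℤ := fun n ↦ ![(-(4 * ((n : ℤ) + 1)), -(12 * ((n : ℤ) + 1))), (4 * ((n : ℤ) + 1), -(12 * ((n : ℤ) + 1)))]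
    with hpdef
  have hV : ∀ n, ∀ v : ℤ × ℤ, v ∈ V n ↔ ((v.1 : ℂ) * ((δ n : ℝ) : ℂ) + (v.2 : ℂ) * ((δ n : ℝ) : ℂ) * Complex.I) ∈
      closure (Literature.Probability.RandomPlanarGeometry.symRect 1 1) := fun n v ↦ h19_box_closure n v
  have hp0 : ∀ n, p n 0 = (-(4 * ((n : ℤ) + 1)), -(12 * ((n : ℤ) + 1))) := fun n ↦ rfl
  have hp1 : ∀ n, p n 1 = (4 * ((n : ℤ) + 1), -(12 * ((n : ℤ) + 1))) := fun n ↦ rfl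
  obtain ⟨κ, hκ, hT⟩ := h19_crux22 h h19_squareConformalMap δ V p (fun n ↦ rfl) hV hp0 hp1
  have hE := h19_boxRatio_eq_conn δ V p (fun n ↦ rfl) hV hp0 hp1
  obtain ⟨a, b, ha, hb, hab⟩ := h19_twoSided_of_limit hκ hT hE
  exact h19_oneArmThird_of_twoPointBounds a b ha hb hab

/-- **Hardness certificate B.** The registered stub `stub_canonicalLimit` (CANON) of the line alone implies crux 6,
`HalfPlaneOneArmThird`: CANON for `(2;2)` on the lattice squares, together with the (landed) Green asymptotics of the
squares, is again the sharp `δ^{2/3}` asymptotics of the boundary two-point connection probability. This is the formal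
content of the lead's `promote-stub` verdict: the stub is crux-6-hard. [folklore] -/
theorem halfPlaneOneArmThird_of_canonicalLimit :
    (∀ (k : ℕ) (L : Fin k → ℕ) (j : Fin k), L j = ∑ i ∈ Finset.univ.erase j, L i → (∃ i, i ≠ j) → (∀ i, i ≠ j → 1 ≤ L i) → ∃ ℓ : ℝ, ∀ (δ : ℕ → ℝ), (∀ n, 0 < δ n) → Filter.Tendsto δ Filter.atTop (nhds 0) → ∀ (V : ℕ → Finset (ℤ × ℤ)), (∀ n, ∀ v : ℤ × ℤ, v ∈ V n ↔ (-(⌊1 / δ n⌋₊ : ℤ) ≤ v.1 ∧ v.1 ≤ ⌊1 / δ n⌋₊) ∧ (-(⌊1 / δ n⌋₊ : ℤ) ≤ v.2 ∧ v.2 ≤ ⌊1 / δ n⌋₊)) → ∀ (p : ℕ → Fin k → ℤ × ℤ), (∀ n i, p n i = (⌊(2 * ((i : ℝ) + 1) / (k + 1) - 1) / δ n⌋, -(⌊1 / δ n⌋₊ : ℤ))) → (∀ n, Function.Injective (p n)) → (∀ n, Literature.Probability.LatticeModels.CollarLegModel.LegInsertionData.IsAdmissible (⟨(Finset.univ.erase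 j).image (p n), fun v ↦ ∑ b ∈ (Finset.univ.erase j).filter (fun b ↦ (p n) b = v), L b, (p n) j⟩ : Literature.Probability.LatticeModels.CollarLegModel.LegInsertionData) (V n)) → Filter.Tendsto (fun n ↦ (Real.log (‖Literature.Probability.LatticeModels.CollarLegModel.Zins (V n) (⟨(Finset.univ.erase j).image (p n), fun v ↦ ∑ b ∈ (Finset.univ.erase j).filter (fun b ↦ (p n) b = v), L b, (p n) j⟩ : Literature.Probability.LatticeModels.CollarLegModel.LegInsertionData)‖ / ‖(Literature.Probability.LatticeModels.CollarLegModel.ofDomain (V n)).Z‖) - (∑ i₁ : Fin k, ∑ i₂ ∈ Finset.univ.filter (fun i₂ : Fin k ↦ i₁ < i₂), (-((if i₁ = j then (1 - (L j : ℝ)) else (L i₁ : ℝ)) * (if i₂ = j then (1 - (L j : ℝ)) else (L i₂ : ℝ))) / 6) * Real.log (Literature.Probability.LatticeModels.dirichletGreen ((V n).image (fun v : ℤ × ℤ ↦ (![v.1, v.2] : Fin 2 → ℤ))) (![((p n) i₁).1, ((p n) i₁).2] : Fin 2 → ℤ) (![((p n) i₂).1, ((p n) i₂).2] : Fin 2 →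 ℤ))))) Filter.atTop (nhds ℓ)) →
    Summit.CriticalPhenomena.CardyFormulaZ2.Theses.CardyBoundaryCoulombGas.HalfPlaneOneArmThird := by
  intro hCANON
  set δ : ℕ → ℝ := fun n ↦ 1 / (12 * ((n : ℝ) + 1)) with hδ
  set V : ℕ → Finset (ℤ × ℤ) := fun n ↦
    (Finset.Icc (-(12 * ((n : ℤ) + 1))) (12 * ((n : ℤ) + 1))) ×ˢ (Finset.Icc (-(12 * ((n : ℤ) + 1))) (12 * ((n : ℤ) + 1)))
    with hVdef
  set p : ℕ → Fin 2 → ℤ × ℤ := fun n ↦ ![(-(4 * ((n : ℤ) + 1)), -(12 * ((n : ℤ) + 1))), (4 * ((n : ℤ) + 1), -(12 * ((n : ℤ) + 1)))]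
    with hpdef
  have hV : ∀ n, ∀ v : ℤ × ℤ, v ∈ V n ↔ ((v.1 : ℂ) * ((δ n : ℝ) : ℂ) + (v.2 : ℂ) * ((δ n : ℝ) : ℂ) * Complex.I) ∈
      closure (Literature.Probability.RandomPlanarGeometry.symRect 1 1) := fun n v ↦ h19_box_closure n v
  have hVbox : ∀ n, ∀ v : ℤ × ℤ, v ∈ V n ↔ (-(12 * ((n : ℤ) + 1)) ≤ v.1 ∧ v.1 ≤ 12 * ((n : ℤ) + 1)) ∧
      (-(12 * ((n : ℤ) + 1)) ≤ v.2 ∧ v.2 ≤ 12 * ((n : ℤ) + 1)) := by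
    intro n v
    simp only [hVdef, Finset.mem_product, Finset.mem_Icc]
  have hp0 : ∀ n, p n 0 = (-(4 * ((n : ℤ) + 1)), -(12 * ((n : ℤ) + 1))) := fun n ↦ rfl
  have hp1 : ∀ n, p n 1 = (4 * ((n : ℤ) + 1), -(12 * ((n : ℤ) + 1))) := fun n ↦ rfl
  have hG := h19_boxGreen h19_squareConformalMap δ V p (fun n ↦ rfl) hV hp0 hp1
  have hE := h19_boxRatio_eq_conn δ V p (fun n ↦ rfl) hV hp0 hp1
  -- positivity of the rainbow ratio, eventually: it is a connection probability (H2), bounded below by `c θ² > 0` (H4)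
  have hposR : ∀ᶠ n in Filter.atTop, 0 < ‖Literature.Probability.LatticeModels.CollarLegModel.Zins (V n)
        (⟨(Finset.univ.erase 1).image (p n), fun v ↦ ∑ i ∈ (Finset.univ.erase 1).filter (fun i ↦ p n i = v),
          (![2, 2] : Fin 2 → ℕ) i, p n 1⟩ : Literature.Probability.LatticeModels.CollarLegModel.LegInsertionData)‖ /
      ‖(Literature.Probability.LatticeModels.CollarLegModel.ofDomain (V n)).Z‖ := by
    obtain ⟨c, hc, N₀, hlow⟩ := h19_armSq_le_conn
    filter_upwards [hE, Filter.eventually_ge_atTop N₀] with n hn hN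
    rw [hn]
    refine lt_of_lt_of_le ?_ (hlow n hN)
    have hθ := Summit.CriticalPhenomena.CardyFormulaZ2.Theorems.HalfPlaneOneArmThird.Negative.prob_pos (p := half)
      (by rw [coe_half]; norm_num) (12 * (n + 1))
    positivity
  obtain ⟨κ, hκ, hT⟩ := h19_canon22 hCANON δ V p (fun n ↦ rfl) hVbox hp0 hp1 hposR hG
  obtain ⟨a, b, ha, hb, hab⟩ := h19_twoSided_of_limit hκ hT hE
  exact h19_oneArmThird_of_twoPointBounds a b ha hb hab

end Summit.CriticalPhenomena.CardyFormulaZ2.Cruxes.BoundaryDefectGaussianR.RainbowMonomialsInExcursionKernels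

end
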